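import Summits.AtomisticToContinuum.HydrodynamicLimit.Theorems.CollisionIsometryCLTAdaptedWeightCLTLine

/-!
# The six probe directions of `cd3` do not control the heat-flux PAST — negative knowledge for the
line `contact-source-duhamel` of the crux `CollisionIsometryCLT.AdaptedWeightCLT`

Negative knowledge for the crux `AdaptedWeightCLT` (stmt-AtomisticToContinuum-12949, route
`CollisionIsometryCLT`), line `contact-source-duhamel` (lead `prover-line-stmt-AtomisticToContinuum-12949-0`,
vocabulary `Theorems/CollisionIsometryCLTAdaptedWeightCLTLine.lean`), from the standing disprover's
`Cruxes/AdaptedWeightCLT/Disproof.lean` §5 (cycle 2; refuter-cdisprove-stmt-AtomisticToContinuum-12949-g2-0).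

The line's column-depolarisation functional `cd3` (the rank-3 half of `CDAlongAt`, produced by
`stub_columnDepolarisation` and consumed by `stub_pastDamping`) evaluates the cubic impulse cloud
`cloud 3 … k a = Σᵢ 𝒯_{0→m}(δ_k a^{⊗3})ᵢ` only at the six probe impulses `a = dirV p q = (e_p + e_q)/‖e_p + e_q‖`.
Along any fold the incoherent transport splits an injected impulse into PIECES: by `mapT` of a power being the
power of the image (`tStep`: `T ↦ Q^{⊗r}T`, `P^{⊗r}T`), `cloud r … k a = Σ_α tpow r (A_α a)` for linear maps
`A_α` (products of the complementary projections met along the branches of the impulse tree of `k`) with the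
energy identity `Σ_α ‖A_α a‖² = ‖a‖²`.  The rank-3 PAST of `stub_pastDamping` pairs the heat-flux tests
`C3 a'` with `𝒯(δ_k y_k^{⊗3}) = Σ_α tpow 3 (A_α y_k)` for the ACTUAL shifted velocities `y_k`, which point
in every direction.  The checked facts below say that the typed `cd3` cannot deliver this:

* `dirV_coord_prod` — every probe direction has a vanishing coordinate product `a₀a₁a₂`: the six probes lie
  on the zero set of the cubic form `xyz` (and of `x²y − xy²`, …): cubic forms on `ℝ³` have TEN coefficients,
  the probes test six;
* `cubic_probe_deficiency` — an explicit isometric family of 36 rank-one pieces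
  `a ↦ (⟨s_α, a⟩/6) e_c` (`s_α` the four sign vectors `(1,1,1), (-1,-1,1), (-1,1,-1), (1,-1,-1)`, each piece
  in three copies) whose rank-2 cloud is EXACTLY depolarised for every impulse (`= iso2 a`, so every `cd2`-type
  functional vanishes), whose cubic cloud VANISHES at all six probes (so `cd3 = 0`), but whose cubic cloud of a
  general impulse is `(a₀a₁a₂/3)·Σ_c e_c^{⊗3}` and is seen by every heat-flux test:
  `⟨C3 p, cloud₃(a)⟩ = a₀a₁a₂/6` (`= 1/6` at `a = e₀ + e₁ + e₂`).
  Hence NO argument using only (isometry, rank-2 depolarisation of all impulses, vanishing of the six probed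
  cubic clouds) bounds the rank-3 PAST: `stub_pastDamping`'s "Rank 3: same with ‖cloud 3‖ → 0 (cd3)" has no
  linear-algebra route as typed;
* `tpow_three_polarization` — the REPAIR is cheap and mechanism-neutral: `y^{⊗3}` is an explicit combination,
  with coefficients cubic in `y`, of the cubes of the TEN directions `e_p`, `e_p ± e_q` (`p < q`), `e₀+e₁+e₂`
  (a cubic-unisolvent set), so a `cd3` summed over these ten (normalised) directions controls
  `𝒯(δ_k y^{⊗3})` for every `y` by linearity, exactly as the six `dirV` do at rank 2;
* `pairT_C3_tpow` — the dictionary `⟨C3 p, y^{⊗3}⟩ = ½ y_p ‖y‖²` used by `stub_reduction` (the heat-flux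
  component), recorded on the way.
-/

noncomputable section

namespace Summit.AtomisticToContinuum.HydrodynamicLimit.Theorems

namespace AdaptedWeightCLTNegative

open scoped BigOperators
open Finset Summit.AtomisticToContinuum.HydrodynamicLimit.Theorems.ContactSourceDuhamel

/-! ## Bookkeeping: sums over multi-indices, components of powers and probes -/

/-- A sum over rank-2 multi-indices is an iterated sum. [folklore] -/
theorem sum_index_two {M : Type*} [AddCommMonoid M] (F : (Fin 2 → Fin 3) → M) :
    ∑ idx, F idx = ∑ i : Fin 3, ∑ j : Fin 3, F ![i, j] := by
  let e : Fin 3 × Fin 3 ≃ (Fin 2 → Fin 3) :=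
    { toFun := fun p => ![p.1, p.2]
      invFun := fun f => (f 0, f 1)
      left_inv := fun p => by simp
      right_inv := fun f => by funext i; fin_cases i <;> rfl }
  rw [← Fintype.sum_equiv e (fun p => F (e p)) F (fun _ => rfl), Fintype.sum_prod_type]
  rfl

/-- A sum over rank-3 multi-indices is an iterated sum. [folklore] -/
theorem sum_index_three {M : Type*} [AddCommMonoid M] (F : (Fin 3 → Fin 3) → M) :
    ∑ idx, F idx = ∑ i : Fin 3, ∑ j : Fin 3, ∑ k : Fin 3, F ![i, j, k] := by
  let e : Fin 3 × Fin 3 × Fin 3 ≃ (Fin 3 → Fin 3) :=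
    { toFun := fun p => ![p.1, p.2.1, p.2.2]
      invFun := fun f => (f 0, f 1, f 2)
      left_inv := fun p => by simp
      right_inv := fun f => by funext i; fin_cases i <;> rfl }
  rw [← Fintype.sum_equiv e (fun p => F (e p)) F (fun _ => rfl), Fintype.sum_prod_type,
    Fintype.sum_congr _ _ (fun i => Fintype.sum_prod_type _)]
  rfl

/-- Components of a rank-2 power. [folklore] -/
theorem tpow_two_apply (y : V3) (idx : Fin 2 → Fin 3) : tpow 2 y idx = y (idx 0) * y (idx 1) := by
  simp [tpow, Fin.prod_univ_two]

/-- Components of a rank-3 power. [folklore] -/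
theorem tpow_three_apply (y : V3) (idx : Fin 3 → Fin 3) :
    tpow 3 y idx = y (idx 0) * y (idx 1) * y (idx 2) := by
  simp [tpow, Fin.prod_univ_three]

/-- Powers are homogeneous: `(t y)^{⊗r} = t^r y^{⊗r}`. [folklore] -/
theorem tpow_smul (r : ℕ) (t : ℝ) (y : V3) : tpow r (t • y) = t ^ r • tpow r y := by
  funext idx
  simp only [tpow, PiLp.smul_apply, smul_eq_mul, Pi.smul_apply, Finset.prod_mul_distrib,
    Finset.prod_const, Finset.card_univ, Fintype.card_fin]

/-- Coordinates of the basis impulses. [folklore] -/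
theorem baseV_apply (c i : Fin 3) : baseV c i = if i = c then 1 else 0 := by
  simp [baseV]

/-- **The six probes lie on the cubic `xyz = 0`.** Every probe direction `dirV p q = (e_p+e_q)/‖e_p+e_q‖` of
the line's `cd2`/`cd3` has a vanishing coordinate, hence a vanishing coordinate product: any cubic cloud
proportional to `a₀a₁a₂` is invisible to `cd3`. [folklore] -/
theorem dirV_coord_prod (p q : Fin 3) : dirV p q 0 * dirV p q 1 * dirV p q 2 = 0 := by
  fin_cases p <;> fin_cases q <;> simp [dirV, baseV_apply]

/-- The heat-flux dictionary of the line: `⟨C3 p, y^{⊗3}⟩ = ½ y_p ‖y‖²` (the `p`-component of the kinetic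
heat flux carried by a peculiar velocity `y`). [folklore] -/
theorem pairT_C3_tpow (p : Fin 3) (y : V3) : pairT (C3 p) (tpow 3 y) = y p * ‖y‖ ^ 2 / 2 := by
  rw [pairT, sum_index_three, EuclideanSpace.real_norm_sq_eq, Fin.sum_univ_three]
  simp only [C3, tpow_three_apply, Matrix.cons_val_zero, Matrix.cons_val_one, Matrix.head_cons,
    Matrix.cons_val_two, Matrix.tail_cons, Fin.sum_univ_three]
  fin_cases p <;> simp <;> ring

/-! ## The counterexample family: 36 isometric rank-one pieces -/

/-- The four sign forms `⟨s_α, a⟩`, `s_α ∈ {(1,1,1), (-1,-1,1), (-1,1,-1), (1,-1,-1)}`: their squares sum to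
`4‖a‖²` (a tight frame) and their cubes to `24 a₀a₁a₂` (the classical identity
`(x+y+z)³ − (x+y−z)³ − (x−y+z)³ − (−x+y+z)³ = 24xyz`). [folklore] -/
theorem sign_forms_sq_and_cube (a : V3) :
    ((a 0 + a 1 + a 2) ^ 2 + (-(a 0 + a 1 - a 2)) ^ 2 + (-(a 0 - a 1 + a 2)) ^ 2 + (a 0 - a 1 - a 2) ^ 2
        = 4 * ‖a‖ ^ 2) ∧
    ((a 0 + a 1 + a 2) ^ 3 + (-(a 0 + a 1 - a 2)) ^ 3 + (-(a 0 - a 1 + a 2)) ^ 3 + (a 0 - a 1 - a 2) ^ 3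
        = 24 * (a 0 * a 1 * a 2)) := by
  rw [EuclideanSpace.real_norm_sq_eq, Fin.sum_univ_three]
  constructor <;> ring

/-- The rank-2 powers of the three basis impulses sum to the identity tensor. [folklore] -/
theorem sum_tpow_two_baseV :
    ∑ c : Fin 3, tpow 2 (baseV c) = fun idx => if idx 0 = idx 1 then (1 : ℝ) else 0 := by
  funext idx
  simp only [Finset.sum_apply, tpow_two_apply, baseV_apply, Fin.sum_univ_three]
  generalize idx 0 = i, idx 1 = j
  fin_cases i <;> fin_cases j <;> simp

/-- The heat-flux tests see the sum of the three basis cubes: `⟨C3 p, Σ_c e_c^{⊗3}⟩ = ½`. [folklore] -/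
theorem pairT_C3_sum_tpow_three_baseV (p : Fin 3) :
    pairT (C3 p) (∑ c : Fin 3, tpow 3 (baseV c)) = 1 / 2 := by
  rw [pairT, sum_index_three]
  simp only [C3, Finset.sum_apply, tpow_three_apply, baseV_apply, Matrix.cons_val_zero,
    Matrix.cons_val_one, Matrix.head_cons, Matrix.cons_val_two, Matrix.tail_cons, Fin.sum_univ_three]
  fin_cases p <;> simp

/-- Pairings are linear in the tensor. [folklore] -/
theorem pairT_smul {r : ℕ} (C T : Tens r) (k : ℝ) : pairT C (k • T) = k * pairT C T := by
  simp only [pairT, Pi.smul_apply, smul_eq_mul, Finset.mul_sum]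
  exact Finset.sum_congr rfl fun idx _ => by ring

/-- **Cubic probe deficiency.** There is a family of 36 linear rank-one "pieces"
`b α c m : a ↦ (⟨s_α, a⟩/6) e_c` (`α ∈ Fin 4` the sign forms, `c ∈ Fin 3` the carried direction,
`m ∈ Fin 3` a multiplicity) such that
(i) the splitting is ISOMETRIC, `Σ ‖b a‖² = ‖a‖²` (the energy identity of every impulse cloud);
(ii) its rank-2 cloud is EXACTLY DEPOLARISED for every impulse, `Σ (b a)^{⊗2} = ‖a‖²𝟙/3 = iso2 a`
(so `cd2 = 0` for any choice of probes);
(iii) its cubic cloud VANISHES at all six probe directions `dirV p q` of the line (so `cd3 = 0`);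
(iv) yet the heat-flux test in every direction `p` sees the cubic cloud of a general impulse,
`⟨C3 p, Σ (b a)^{⊗3}⟩ = a₀a₁a₂/6`, e.g. `1/6` at `a = e₀ + e₁ + e₂`.
Consequently "cd2 → 0 ∧ cd3 → 0" (the typed `CDAlongAt`) does not control the pairing of the heat-flux
tests with the transported cubic tensors `𝒯(δ_k y_k^{⊗3}) = Σ_α (A_α y_k)^{⊗3}` of ARBITRARY window-start
velocities `y_k` through the three properties (isometry, rank-2 depolarisation, six probed cubic clouds)
alone: the rank-3 half of `stub_pastDamping` has no proof by linearity from `CDAlongAt` as typed — the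
functional `cd3` must probe a cubic-unisolvent set of directions (`tpow_three_polarization`). [folklore] -/
theorem cubic_probe_deficiency :
    ∃ b : Fin 4 → Fin 3 → Fin 3 → V3 → V3,
      (∀ α c m (x y : V3) (t : ℝ), b α c m (t • x + y) = t • b α c m x + b α c m y) ∧
      (∀ a, ∑ α, ∑ c, ∑ m, ‖b α c m a‖ ^ 2 = ‖a‖ ^ 2) ∧
      (∀ a, ∑ α, ∑ c, ∑ m, tpow 2 (b α c m a) = iso2 a) ∧
      (∀ p q, ∑ α, ∑ c, ∑ m, tpow 3 (b α c m (dirV p q)) = 0) ∧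
      (∀ a (p : Fin 3), pairT (C3 p) (∑ α, ∑ c, ∑ m, tpow 3 (b α c m a)) = a 0 * a 1 * a 2 / 6) ∧
      pairT (C3 0) (∑ α, ∑ c, ∑ m, tpow 3 (b α c m (baseV 0 + baseV 1 + baseV 2))) = 1 / 6 := by
  -- the four sign forms
  let L : Fin 4 → V3 → ℝ :=
    ![fun a => a 0 + a 1 + a 2, fun a => -(a 0 + a 1 - a 2), fun a => -(a 0 - a 1 + a 2),
      fun a => a 0 - a 1 - a 2]
  have hL : ∀ α (x y : V3) (t : ℝ), L α (t • x + y) = t * L α x + L α y := by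
    intro α x y t
    fin_cases α <;> simp [L] <;> ring
  have hL2 : ∀ a : V3, ∑ α, L α a ^ 2 = 4 * ‖a‖ ^ 2 := by
    intro a
    rw [← (sign_forms_sq_and_cube a).1, Fin.sum_univ_four]
    simp [L]
  have hL3 : ∀ a : V3, ∑ α, L α a ^ 3 = 24 * (a 0 * a 1 * a 2) := by
    intro a
    rw [← (sign_forms_sq_and_cube a).2, Fin.sum_univ_four]
    simp [L]
  -- the cubic cloud of the family in closed form
  have hcube : ∀ a : V3, ∑ α : Fin 4, ∑ c : Fin 3, ∑ _m : Fin 3, tpow 3 ((L α a / 6) • baseV c)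
      = (a 0 * a 1 * a 2 / 3) • ∑ c : Fin 3, tpow 3 (baseV c) := by
    intro a
    simp only [tpow_smul, Finset.sum_const, Finset.card_univ, Fintype.card_fin,
      ← Nat.cast_smul_eq_nsmul ℝ, smul_smul]
    rw [Finset.sum_comm, Finset.smul_sum]
    refine Finset.sum_congr rfl fun c _ => ?_
    rw [← Finset.sum_smul]
    congr 1
    have h72 : ∀ α, ((3 : ℕ) : ℝ) * (L α a / 6) ^ 3 = L α a ^ 3 / 72 := fun α => by push_cast; ring
    simp_rw [h72, ← Finset.sum_div, hL3]
    ring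
  -- the rank-2 cloud of the family in closed form
  have hsquare : ∀ a : V3, ∑ α : Fin 4, ∑ c : Fin 3, ∑ _m : Fin 3, tpow 2 ((L α a / 6) • baseV c)
      = (‖a‖ ^ 2 / 3) • ∑ c : Fin 3, tpow 2 (baseV c) := by
    intro a
    simp only [tpow_smul, Finset.sum_const, Finset.card_univ, Fintype.card_fin,
      ← Nat.cast_smul_eq_nsmul ℝ, smul_smul]
    rw [Finset.sum_comm, Finset.smul_sum]
    refine Finset.sum_congr rfl fun c _ => ?_
    rw [← Finset.sum_smul]
    congr 1
    have h12 : ∀ α, ((3 : ℕ) : ℝ) * (L α a / 6) ^ 2 = L α a ^ 2 / 12 := fun α => by push_cast; ring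
    simp_rw [h12, ← Finset.sum_div, hL2]
    ring
  refine ⟨fun α c _ a => (L α a / 6) • baseV c, ?_, ?_, ?_, ?_, ?_, ?_⟩
  · -- linearity of every piece
    intro α c m x y t
    simp only [hL, add_div, add_smul, mul_div_assoc, mul_smul]
  · -- isometry
    intro a
    have hn : ∀ c : Fin 3, ‖baseV c‖ = 1 := fun c => by simp [baseV]
    simp only [norm_smul, hn, mul_one, Real.norm_eq_abs, sq_abs, Finset.sum_const, Finset.card_univ,
      Fintype.card_fin, nsmul_eq_mul, div_pow]
    push_cast
    have h4 : ∀ α, (3 : ℝ) * (3 * (L α a ^ 2 / 6 ^ 2)) = L α a ^ 2 / 4 := fun α => by ring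
    simp_rw [h4, ← Finset.sum_div, hL2]
    ring
  · -- exact rank-2 depolarisation
    intro a
    rw [hsquare, sum_tpow_two_baseV]
    funext idx
    simp only [iso2, Pi.smul_apply, smul_eq_mul, mul_ite, mul_one, mul_zero]
  · -- the six probes see nothing
    intro p q
    rw [hcube, dirV_coord_prod, zero_div, zero_smul]
  · -- every heat-flux test sees a₀a₁a₂/6
    intro a p
    rw [hcube, pairT_smul, pairT_C3_sum_tpow_three_baseV]
    ring
  · -- the impulse e₀+e₁+e₂
    rw [hcube, pairT_smul, pairT_C3_sum_tpow_three_baseV]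
    simp [baseV_apply]
    norm_num

/-! ## The repair: ten directions are enough (and needed) at rank 3 -/

/-- **Rank-3 polarization over ten directions.** Every cube `y^{⊗3}` is an explicit combination, with
coefficients cubic in `y`, of the cubes of the ten directions `e_p` (`p = 0,1,2`), `e_p + e_q`, `e_p − e_q`
(`p < q`) and `e₀ + e₁ + e₂` — a cubic-unisolvent set (no non-zero cubic form on `ℝ³` vanishes on all ten).
Hence a column-depolarisation functional that sums `‖cloud 3 … k d‖²` over these ten (normalised) directions
`d` controls `𝒯(δ_k y^{⊗3}) = Σ_α (A_α y)^{⊗3}` for EVERY `y` by linearity of the transport, with coefficients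
`≤ 3‖y‖³`; the six `dirV p q` of the typed `cd3` cannot (`cubic_probe_deficiency`).  This is the corrected
interface between `stub_columnDepolarisation` and `stub_pastDamping` for the heat-flux channel. [folklore] -/
theorem tpow_three_polarization (y : V3) :
    tpow 3 y =
      ∑ p : Fin 3, (y p ^ 3 - y p * (‖y‖ ^ 2 - y p ^ 2) + y 0 * y 1 * y 2) • tpow 3 (baseV p)
      + ((y 0 ^ 2 * y 1 + y 0 * y 1 ^ 2) / 2 - y 0 * y 1 * y 2) • tpow 3 (baseV 0 + baseV 1)
      + ((y 0 ^ 2 * y 2 + y 0 * y 2 ^ 2) / 2 - y 0 * y 1 * y 2) • tpow 3 (baseV 0 + baseV 2)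
      + ((y 1 ^ 2 * y 2 + y 1 * y 2 ^ 2) / 2 - y 0 * y 1 * y 2) • tpow 3 (baseV 1 + baseV 2)
      + (y 0 * y 1 * (y 1 - y 0) / 2) • tpow 3 (baseV 0 - baseV 1)
      + (y 0 * y 2 * (y 2 - y 0) / 2) • tpow 3 (baseV 0 - baseV 2)
      + (y 1 * y 2 * (y 2 - y 1) / 2) • tpow 3 (baseV 1 - baseV 2)
      + (y 0 * y 1 * y 2) • tpow 3 (baseV 0 + baseV 1 + baseV 2) := by
  rw [EuclideanSpace.real_norm_sq_eq, Fin.sum_univ_three]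
  funext idx
  simp only [tpow_three_apply, Pi.add_apply, Pi.smul_apply, smul_eq_mul,
    Fin.sum_univ_three, PiLp.add_apply, PiLp.sub_apply, baseV_apply]
  generalize idx 0 = i, idx 1 = j, idx 2 = k
  fin_cases i <;> fin_cases j <;> fin_cases k <;>
    simp [-mul_eq_mul_right_iff, -mul_eq_mul_left_iff] <;> ring

end AdaptedWeightCLTNegative

end Summit.AtomisticToContinuum.HydrodynamicLimit.Theorems

end
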